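import Literature.Barriers.FinalStateConjecture.ExtremalHorizonChargeConservationProofs
import Literature.Geometry.Lorentzian.KerrAxialSymmetry
import Literature.Analysis.FunctionSpaces.SmoothParametricIntegral
import Mathlib.Geometry.Manifold.PartitionOfUnity
import Mathlib.MeasureTheory.Integral.IntervalIntegral.Periodic
import HarnessLib

/-!
# Barrier catalogue `FinalStateConjecture`: the projection of solutions of the wave equation on
# extremal Kerr to their axisymmetric part (`Literature/Barriers/FinalStateConjecture/`, D-0014;
# family `gr`)

Aretakis proves Theorem 3 of ATMP 19 (2015) "by projecting to the zeroth azimuthal frequency":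
the average `ψ₀ = ∫₀^{2π} ψ ∘ R_α dα` of a solution `ψ` over the axial rotations `R_α` (the flow of
the Killing field `Φ = ∂_{φ*}`) is again a solution, it is axisymmetric, it has the same conserved
charge `H₀` up to the factor `2π`, and lower bounds for `|Yψ₀|`, `|YYψ₀|` on the `R_α`-invariant
horizon spheres `S_τ` transfer to `ψ`. This file formalises this projection for the class of
solutions of the named fact `Aretakis2015_scalarInstability` (smooth solutions on an open set
`U ⊇ K = {r ≥ M} ∩ {t* ≥ 0}` of the extremal Kerr–Schild chart with localised data):

* rotation-invariant open sets `⊇ K` inside `U` (`Kerr.isOpen_setOf_forall_axialRotate_mem`, tube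
  lemma over the compact period `[0, 2π]`);
* a smooth cutoff `χ` equal to `1` near `K` with `tsupport χ ⊆ U` (smooth Urysohn lemma on `E4`),
  the globally smooth representative `Kerr.rotAverage χ ψ = ∫₀^{2π} (χ · Ψ) ∘ R_α dα`
  (`Ψ = extend ψ 0`; smoothness by `Literature.Analysis.FunctionSpaces.contDiff_parametric_intervalIntegral`)
  and its derivatives under the integral sign;
* **`□_g` commutes with the axial rotations** (`Kerr.dalembertian_comp_axialRotate`, from the
  equivariance of `g⁻¹` and of `∑ ∂_μ g^{μν}`, `KerrAxialSymmetry.lean`) and hence annihilates the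
  average; localisation of the data and axisymmetry of the average; `H₀[ψ₀] = 2π H₀[ψ]`;
  `Yψ₀ = ∫ (Yψ) ∘ R_α`, `YYψ₀ = ∫ (YYψ) ∘ R_α` on the horizon spheres and the transfer of lower bounds;
* the closure of the class under `T = ∂_{t*}` (stationarity of `□_g`).

These are the ingredients of the reduction of `Aretakis2015_scalarInstability` to the conservation
law (proved, `Aretakis2015_chargeConservation_holds`) and the two analytic named facts of
`ExtremalHorizonAxisymmetricDecay.lean`.

## References

* S. Aretakis, *Horizon instability of extremal black holes*, Adv. Theor. Math. Phys. 19 (2015)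
  507–530 (arXiv:1206.6598), §5.2 and the sentence before Thm. 3 (key `Aretakis2015`).
* S. Aretakis, J. Funct. Anal. 263 (2012) 2770–2831, §3 (axisymmetric solutions) (key `Aretakis2012`).
* B. O'Neill, *The geometry of Kerr black holes*, 1995, Ch. 2, §2.2 (key `ONeill1995`).
-/

noncomputable section

open Set Filter MeasureTheory intervalIntegral
open scoped Topology ContDiff Manifold

namespace Literature.Barriers.FinalStateConjecture.Kerr

open Literature.Geometry.Lorentzian

/-! ### Periodicity of the rotations and the invariant open sets -/

/-- `R_{α + 2π} = R_α`. [folklore] -/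
theorem axialRotation_add_two_pi (α : ℝ) (x : E4) :
    E4.axialRotation (α + 2 * Real.pi) x = E4.axialRotation α x := by
  ext i
  fin_cases i <;> simp [Real.cos_add_two_pi, Real.sin_add_two_pi]

/-- The orbit map `α ↦ R_α x` is `2π`-periodic. [folklore] -/
theorem periodic_axialRotation (x : E4) :
    Function.Periodic (fun α ↦ E4.axialRotation α x) (2 * Real.pi) :=
  fun α ↦ axialRotation_add_two_pi α x

/-- Every rotation is a rotation by an angle in `[0, 2π]`. [folklore] -/
theorem exists_mem_Icc_axialRotation_eq (α : ℝ) (x : E4) :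
    ∃ β ∈ Icc (0 : ℝ) (2 * Real.pi), E4.axialRotation α x = E4.axialRotation β x := by
  obtain ⟨β, hβ, h⟩ := (periodic_axialRotation x).exists_mem_Ico₀ Real.two_pi_pos α
  exact ⟨β, Ico_subset_Icc_self hβ, h⟩

/-- On the chart: every `Kerr.axialRotate` is one by an angle in `[0, 2π]`. [folklore] -/
theorem exists_mem_Icc_axialRotate_eq {a r₀ : ℝ} (α : ℝ) (x : Kerr.region a r₀) :
    ∃ β ∈ Icc (0 : ℝ) (2 * Real.pi), Kerr.axialRotate a r₀ α x = Kerr.axialRotate a r₀ β x := by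
  obtain ⟨β, hβ, h⟩ := exists_mem_Icc_axialRotation_eq α (x : E4)
  exact ⟨β, hβ, Subtype.ext h⟩

/-- The flow with swapped arguments, `(x, α) ↦ R_α x`, is continuous (componentwise; the order
`(point, angle)` is the one of the tube lemma). [folklore] -/
theorem continuous_axialRotation_swap : Continuous fun z : E4 × ℝ ↦ E4.axialRotation z.2 z.1 := by
  have h : ∀ z : E4 × ℝ, E4.axialRotation z.2 z.1 = WithLp.toLp 2 ![z.1 0,
      Real.cos z.2 * z.1 1 - Real.sin z.2 * z.1 2, Real.sin z.2 * z.1 1 + Real.cos z.2 * z.1 2, z.1 3] :=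
    fun z ↦ rfl
  simp only [h]
  have hc : ∀ j : Fin 4, Continuous fun z : E4 × ℝ ↦ z.1 j := fun j ↦
    (PiLp.continuous_apply 2 _ j).comp continuous_fst
  have hcos : Continuous fun z : E4 × ℝ ↦ Real.cos z.2 := Real.continuous_cos.comp continuous_snd
  have hsin : Continuous fun z : E4 × ℝ ↦ Real.sin z.2 := Real.continuous_sin.comp continuous_snd
  exact continuous_toLp_four (hc 0) ((hcos.mul (hc 1)).sub (hsin.mul (hc 2)))
    ((hsin.mul (hc 1)).add (hcos.mul (hc 2))) (hc 3)

/-- The chart flow with swapped arguments is continuous. [folklore] -/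
theorem continuous_axialRotate_swap (a r₀ : ℝ) :
    Continuous fun z : Kerr.region a r₀ × ℝ ↦ Kerr.axialRotate a r₀ z.2 z.1 := by
  refine Continuous.subtype_mk ?_ _
  have hc : ∀ j : Fin 4, Continuous fun z : Kerr.region a r₀ × ℝ ↦ (z.1 : E4) j := fun j ↦
    (PiLp.continuous_apply 2 _ j).comp (continuous_subtype_val.comp continuous_fst)
  have hcos : Continuous fun z : Kerr.region a r₀ × ℝ ↦ Real.cos z.2 :=
    Real.continuous_cos.comp continuous_snd
  have hsin : Continuous fun z : Kerr.region a r₀ × ℝ ↦ Real.sin z.2 :=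
    Real.continuous_sin.comp continuous_snd
  have h : ∀ z : Kerr.region a r₀ × ℝ, E4.axialRotation z.2 (z.1 : E4) = WithLp.toLp 2 ![(z.1 : E4) 0,
      Real.cos z.2 * (z.1 : E4) 1 - Real.sin z.2 * (z.1 : E4) 2,
      Real.sin z.2 * (z.1 : E4) 1 + Real.cos z.2 * (z.1 : E4) 2, (z.1 : E4) 3] := fun z ↦ rfl
  show Continuous fun z : Kerr.region a r₀ × ℝ ↦ E4.axialRotation z.2 (z.1 : E4)
  simp only [h]
  exact continuous_toLp_four (hc 0) ((hcos.mul (hc 1)).sub (hsin.mul (hc 2)))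
    ((hsin.mul (hc 1)).add (hcos.mul (hc 2))) (hc 3)

/-- **Tube lemma for the axial rotations of the chart**: for an open set `U` of the chart, the set
of points whose whole `R_α`-orbit lies in `U` is open (the orbit is the continuous image of the
compact period `[0, 2π]`). [folklore] -/
theorem isOpen_setOf_forall_axialRotate_mem {a r₀ : ℝ} {U : Set (Kerr.region a r₀)} (hU : IsOpen U) :
    IsOpen {x : Kerr.region a r₀ | ∀ α : ℝ, Kerr.axialRotate a r₀ α x ∈ U} := by
  refine isOpen_iff_mem_nhds.mpr fun x hx ↦ ?_
  have hc := continuous_axialRotate_swap a r₀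
  have hP : ∀ β ∈ Icc (0 : ℝ) (2 * Real.pi), ∀ᶠ z : Kerr.region a r₀ × ℝ in 𝓝 (x, β),
      Kerr.axialRotate a r₀ z.2 z.1 ∈ U := fun β _ ↦
    hc.continuousAt.eventually_mem (hU.mem_nhds (hx β))
  have h := isCompact_Icc.eventually_forall_of_forall_eventually
    (P := fun (y : Kerr.region a r₀) (β : ℝ) ↦ Kerr.axialRotate a r₀ β y ∈ U) hP
  refine Filter.mem_of_superset h fun y hy ↦ ?_
  simp only [mem_setOf_eq] at hy ⊢
  intro α
  obtain ⟨β, hβ, hαβ⟩ := exists_mem_Icc_axialRotate_eq α y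
  rw [hαβ]
  exact hy β hβ

/-- The same on the coordinate space `E4`. [folklore] -/
theorem isOpen_setOf_forall_axialRotation_mem {V : Set E4} (hV : IsOpen V) :
    IsOpen {x : E4 | ∀ α : ℝ, E4.axialRotation α x ∈ V} := by
  refine isOpen_iff_mem_nhds.mpr fun x hx ↦ ?_
  have hc := continuous_axialRotation_swap
  have hP : ∀ β ∈ Icc (0 : ℝ) (2 * Real.pi), ∀ᶠ z : E4 × ℝ in 𝓝 (x, β),
      E4.axialRotation z.2 z.1 ∈ V := fun β _ ↦
    hc.continuousAt.eventually_mem (hV.mem_nhds (hx β))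
  have h := isCompact_Icc.eventually_forall_of_forall_eventually
    (P := fun (y : E4) (β : ℝ) ↦ E4.axialRotation β y ∈ V) hP
  refine Filter.mem_of_superset h fun y hy ↦ ?_
  simp only [mem_setOf_eq] at hy ⊢
  intro α
  obtain ⟨β, hβ, hαβ⟩ := exists_mem_Icc_axialRotation_eq α y
  rw [hαβ]
  exact hy β hβ

/-- The rotations move the horizon points along the spheres:
`R_α p_σ(θ, φ) = p_σ(θ, φ + α)`. [folklore] -/
theorem axialRotation_horizonPoint (α M σ θ φ : ℝ) :
    E4.axialRotation α (horizonPoint M σ θ φ) = horizonPoint M σ θ (φ + α) := by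
  ext i
  fin_cases i <;> simp [horizonPoint_eq_toLp, Real.cos_add, Real.sin_add] <;> ring

/-- In particular on the initial sphere. [folklore] -/
theorem axialRotation_extremalHorizonPoint (α M θ φ : ℝ) :
    E4.axialRotation α (extremalHorizonPoint M θ φ) = extremalHorizonPoint M θ (φ + α) := by
  have h := axialRotation_horizonPoint α M 0 θ φ
  simpa [horizonPoint] using h

/-- The set `K = {r ≥ r₊} ∩ {t* ≥ 0}` of the named facts, in the coordinate space. [folklore] -/
theorem isClosed_horizonFutureSet (M a : ℝ) :
    IsClosed {x : E4 | Kerr.rPlus M a ≤ Kerr.radius a x ∧ 0 ≤ x 0} := by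
  have h1 : IsClosed {x : E4 | Kerr.rPlus M a ≤ Kerr.radius a x} :=
    isClosed_le continuous_const (Kerr.continuous_radius a)
  have h2 : IsClosed {x : E4 | 0 ≤ x 0} := isClosed_le continuous_const (PiLp.continuous_apply 2 _ 0)
  exact h1.inter h2

/-- `K` is invariant under the rotations. [folklore] -/
theorem axialRotation_mem_horizonFutureSet_iff {M a α : ℝ} {x : E4} :
    E4.axialRotation α x ∈ {x : E4 | Kerr.rPlus M a ≤ Kerr.radius a x ∧ 0 ≤ x 0} ↔
      x ∈ {x : E4 | Kerr.rPlus M a ≤ Kerr.radius a x ∧ 0 ≤ x 0} := by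
  simp only [mem_setOf_eq, Kerr.radius_axialRotation, E4.axialRotation_apply_zero]

/-! ### The smooth cutoff and the averaged representative -/

/-- **A smooth cutoff for a closed set inside an open set of `E4`**: `χ` smooth, `χ = 1` on an
open neighbourhood of the closed set `K'`, `tsupport χ ⊆ V` (smooth Urysohn lemma with
neighbourhoods, `exists_contMDiffMap_zero_one_nhds_of_isClosed`, applied to `Vᶜ` and `K'`).
[folklore] -/
theorem exists_smooth_cutoff {K' V : Set E4} (hK' : IsClosed K') (hV : IsOpen V) (hKV : K' ⊆ V) :
    ∃ (χ : E4 → ℝ) (N : Set E4), ContDiff ℝ ∞ χ ∧ IsOpen N ∧ K' ⊆ N ∧ N ⊆ V ∧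
      (∀ x ∈ N, χ x = 1) ∧ tsupport χ ⊆ V := by
  have hd : Disjoint Vᶜ K' := disjoint_compl_left_iff.mpr hKV
  obtain ⟨f, hf0, hf1, -⟩ := exists_contMDiffMap_zero_one_nhds_of_isClosed 𝓘(ℝ, E4)
    hV.isClosed_compl hK' hd (n := (⊤ : ℕ∞))
  obtain ⟨O, hO, hVO, hfO⟩ : ∃ O : Set E4, IsOpen O ∧ Vᶜ ⊆ O ∧ ∀ x ∈ O, f x = 0 := by
    obtain ⟨O, hO, hO', h⟩ := mem_nhdsSet_iff_exists.mp hf0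
    exact ⟨O, hO, hO', fun x hx ↦ h hx⟩
  obtain ⟨N₁, hN₁, hKN₁, hfN₁⟩ : ∃ N₁ : Set E4, IsOpen N₁ ∧ K' ⊆ N₁ ∧ ∀ x ∈ N₁, f x = 1 := by
    obtain ⟨N₁, hN₁, hN₁', h⟩ := mem_nhdsSet_iff_exists.mp hf1
    exact ⟨N₁, hN₁, hN₁', fun x hx ↦ h hx⟩
  refine ⟨f, N₁ ∩ V, ?_, hN₁.inter hV, subset_inter hKN₁ hKV, inter_subset_right,
    fun x hx ↦ hfN₁ x hx.1, ?_⟩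
  · exact contMDiff_iff_contDiff.mp f.contMDiff
  · -- `support f ⊆ Oᶜ`, a closed subset of `V`
    have hsupp : Function.support f ⊆ Oᶜ := fun x hx hxO ↦ hx (hfO x hxO)
    exact (closure_minimal hsupp hO.isClosed_compl).trans (compl_subset_comm.mp hVO)

/-- **A globally smooth product** `χ · Ψ` when `χ` is smooth with `tsupport χ` inside the open set on
which `Ψ` is smooth. [folklore] -/
theorem contDiff_cutoff_mul {χ Ψ : E4 → ℝ} {V : Set E4} (hχ : ContDiff ℝ ∞ χ)
    (hsupp : tsupport χ ⊆ V) (hΨ : ∀ x ∈ V, ContDiffAt ℝ ∞ Ψ x) :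
    ContDiff ℝ ∞ fun x ↦ χ x * Ψ x := by
  rw [contDiff_iff_contDiffAt]
  intro x
  by_cases hx : x ∈ V
  · exact hχ.contDiffAt.mul (hΨ x hx)
  · have hx' : x ∉ tsupport χ := fun h ↦ hx (hsupp h)
    have hev : (fun y ↦ χ y * Ψ y) =ᶠ[𝓝 x] fun _ ↦ 0 := by
      have h0 : χ =ᶠ[𝓝 x] 0 := by
        rwa [notMem_tsupport_iff_eventuallyEq] at hx'
      filter_upwards [h0] with y hy
      simp [hy]
    exact (contDiffAt_const (c := (0 : ℝ))).congr_of_eventuallyEq hev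

/-- **The averaged representative** `x ↦ ∫₀^{2π} G(R_α x) dα` of a function `G : E4 → ℝ` over the
axial rotations (for `G = χ · extend ψ 0` this is the smooth representative of the axisymmetric
part `ψ₀` of `ψ`; Aretakis's "projection to the zeroth azimuthal frequency", up to the factor
`2π`). [cite: Aretakis2015, §5.2 (before Thm. 3)] -/
def rotAverage (G : E4 → ℝ) (x : E4) : ℝ :=
  ∫ α in (0 : ℝ)..2 * Real.pi, G (E4.axialRotation α x)

/-- The average as a parametric integral of `H(α, x) = G(R_α x)`. [folklore] -/
theorem rotAverage_eq (G : E4 → ℝ) :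
    rotAverage G = fun x ↦ ∫ α in (0 : ℝ)..2 * Real.pi,
      (fun q : ℝ × E4 ↦ G (E4.axialRotation q.1 q.2)) (α, x) := rfl

/-- **The average of a smooth function is smooth** (smooth dependence of parametric integrals,
`contDiff_parametric_intervalIntegral_comp`, with the smooth flow `(α, x) ↦ R_α x`). [folklore] -/
theorem contDiff_rotAverage {G : E4 → ℝ} (hG : ContDiff ℝ ∞ G) : ContDiff ℝ ∞ (rotAverage G) := by
  rw [rotAverage_eq]
  exact Literature.Analysis.FunctionSpaces.contDiff_parametric_intervalIntegral_comp hG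
    E4.contDiff_axialRotation_uncurry 0 (2 * Real.pi)

/-- The integrand `(α, x) ↦ G(R_α x)` is smooth. [folklore] -/
theorem contDiff_comp_axialRotation_uncurry {G : E4 → ℝ} {n : WithTop ℕ∞} (hG : ContDiff ℝ n G) :
    ContDiff ℝ n fun q : ℝ × E4 ↦ G (E4.axialRotation q.1 q.2) :=
  hG.comp E4.contDiff_axialRotation_uncurry

/-- A partial derivative in the space variable is the derivative of the slice:
`DK(α, x)(0, v) = D[K(α, ·)](x) v`. [folklore] -/
theorem fderiv_inr_eq_fderiv_slice {F : Type*} [NormedAddCommGroup F] [NormedSpace ℝ F]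
    {K : ℝ × E4 → F} {α : ℝ} {x : E4} (hK : DifferentiableAt ℝ K (α, x)) (v : E4) :
    fderiv ℝ K (α, x) ((0 : ℝ), v) = fderiv ℝ (fun x' : E4 ↦ K (α, x')) x v := by
  have hslice : HasFDerivAt (fun x' : E4 ↦ ((α, x') : ℝ × E4)) (ContinuousLinearMap.inr ℝ ℝ E4) x :=
    (hasFDerivAt_const α x).prodMk (hasFDerivAt_id x)
  have h := (hK.hasFDerivAt.comp x hslice).fderiv
  rw [show (K ∘ fun x' : E4 ↦ ((α, x') : ℝ × E4)) = fun x' ↦ K (α, x') from rfl] at h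
  rw [h]
  simp

/-- The partial derivative of the integrand in the space variable:
`D[(α, x) ↦ G(R_α x)](α, x)(0, v) = DG(R_α x)(R_α v)`. [folklore] -/
theorem fderiv_comp_axialRotation_inr {G : E4 → ℝ} (hG : ContDiff ℝ 1 G) (α : ℝ) (x v : E4) :
    fderiv ℝ (fun q : ℝ × E4 ↦ G (E4.axialRotation q.1 q.2)) (α, x) ((0 : ℝ), v) =
      fderiv ℝ G (E4.axialRotation α x) (E4.axialRotation α v) := by
  have hH : DifferentiableAt ℝ (fun q : ℝ × E4 ↦ G (E4.axialRotation q.1 q.2)) (α, x) :=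
    (contDiff_comp_axialRotation_uncurry hG).differentiable one_ne_zero (α, x)
  rw [fderiv_inr_eq_fderiv_slice hH]
  have hGd : DifferentiableAt ℝ G (E4.axialRotation α x) := hG.differentiable one_ne_zero _
  rw [show (fun x' : E4 ↦ G (E4.axialRotation α x')) = G ∘ (E4.axialRotation α) from rfl,
    fderiv_comp x hGd (E4.axialRotation α).differentiableAt, (E4.axialRotation α).fderiv]
  rfl

/-- **First derivatives of the average under the integral sign**:
`D(∫ G∘R_α)(x) v = ∫ DG(R_α x)(R_α v) dα`. [folklore] -/
theorem fderiv_rotAverage_apply {G : E4 → ℝ} (hG : ContDiff ℝ ∞ G) (x v : E4) :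
    fderiv ℝ (rotAverage G) x v =
      ∫ α in (0 : ℝ)..2 * Real.pi, fderiv ℝ G (E4.axialRotation α x) (E4.axialRotation α v) := by
  rw [rotAverage_eq, Literature.Analysis.FunctionSpaces.fderiv_parametric_intervalIntegral_apply
    (contDiff_comp_axialRotation_uncurry hG) (WithTop.coe_ne_zero.mpr ENat.top_ne_zero)]
  exact intervalIntegral.integral_congr fun α _ ↦
    fderiv_comp_axialRotation_inr (hG.of_le (by exact_mod_cast le_top)) α x v

/-- The integrand of the first-derivative formula, `(α, x) ↦ DG(R_α x)(R_α w)`, is smooth. [folklore] -/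
theorem contDiff_fderiv_comp_axialRotation {G : E4 → ℝ} (hG : ContDiff ℝ ∞ G) (w : E4) :
    ContDiff ℝ ∞ fun q : ℝ × E4 ↦
      fderiv ℝ G (E4.axialRotation q.1 q.2) (E4.axialRotation q.1 w) := by
  have h1 : ContDiff ℝ ∞ fun q : ℝ × E4 ↦ fderiv ℝ G (E4.axialRotation q.1 q.2) :=
    (hG.fderiv_right (m := ∞) le_rfl).comp E4.contDiff_axialRotation_uncurry
  have h2 : ContDiff ℝ ∞ fun q : ℝ × E4 ↦ E4.axialRotation q.1 w :=
    E4.contDiff_axialRotation_uncurry.comp (contDiff_fst.prodMk contDiff_const)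
  exact h1.clm_apply h2

/-- **Second derivatives of the average under the integral sign**:
`D²(∫ G∘R_α)(x)(u, w) = ∫ D²G(R_α x)(R_α u, R_α w) dα`. [folklore] -/
theorem fderiv_fderiv_rotAverage_apply {G : E4 → ℝ} (hG : ContDiff ℝ ∞ G) (x u w : E4) :
    fderiv ℝ (fderiv ℝ (rotAverage G)) x u w =
      ∫ α in (0 : ℝ)..2 * Real.pi,
        fderiv ℝ (fderiv ℝ G) (E4.axialRotation α x) (E4.axialRotation α u) (E4.axialRotation α w) := by
  have hR := contDiff_rotAverage hG
  -- `D²Ψ₀(x)(u, w) = D[q ↦ DΨ₀(q) w](x) u`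
  have hB : HasFDerivAt (fderiv ℝ (rotAverage G)) (fderiv ℝ (fderiv ℝ (rotAverage G)) x) x :=
    ((hR.fderiv_right (m := ∞) le_rfl).differentiable (WithTop.coe_ne_zero.mpr ENat.top_ne_zero) x).hasFDerivAt
  have h1 : fderiv ℝ (fderiv ℝ (rotAverage G)) x u w =
      fderiv ℝ (fun q ↦ fderiv ℝ (rotAverage G) q w) x u := by
    have h' : HasFDerivAt (fun q ↦ fderiv ℝ (rotAverage G) q w)
        ((fderiv ℝ (fderiv ℝ (rotAverage G)) x).flip w) x := by
      simpa using hB.clm_apply (hasFDerivAt_const w x)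
    rw [h'.fderiv, ContinuousLinearMap.flip_apply]
  rw [h1]
  -- the function `q ↦ DΨ₀(q) w` is the parametric integral of `K_w`
  have hfun : (fun q ↦ fderiv ℝ (rotAverage G) q w) = fun q ↦ ∫ α in (0 : ℝ)..2 * Real.pi,
      (fun z : ℝ × E4 ↦ fderiv ℝ G (E4.axialRotation z.1 z.2) (E4.axialRotation z.1 w)) (α, q) :=
    funext fun q ↦ fderiv_rotAverage_apply hG q w
  rw [hfun, Literature.Analysis.FunctionSpaces.fderiv_parametric_intervalIntegral_apply
    (contDiff_fderiv_comp_axialRotation hG w) (WithTop.coe_ne_zero.mpr ENat.top_ne_zero)]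
  refine intervalIntegral.integral_congr fun α _ ↦ ?_
  have hK : DifferentiableAt ℝ
      (fun z : ℝ × E4 ↦ fderiv ℝ G (E4.axialRotation z.1 z.2) (E4.axialRotation z.1 w)) (α, x) :=
    (contDiff_fderiv_comp_axialRotation hG w).differentiable (WithTop.coe_ne_zero.mpr ENat.top_ne_zero) _
  rw [fderiv_inr_eq_fderiv_slice hK]
  -- slice: `x' ↦ (DG (R x')) (R w)`, derivative `D²G(R x)(R u)(R w)`
  have hGB : HasFDerivAt (fderiv ℝ G) (fderiv ℝ (fderiv ℝ G) (E4.axialRotation α x))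
      (E4.axialRotation α x) :=
    ((hG.fderiv_right (m := ∞) le_rfl).differentiable (WithTop.coe_ne_zero.mpr ENat.top_ne_zero) _).hasFDerivAt
  have hcomp : HasFDerivAt (fun x' : E4 ↦ fderiv ℝ G (E4.axialRotation α x'))
      ((fderiv ℝ (fderiv ℝ G) (E4.axialRotation α x)).comp (E4.axialRotation α)) x :=
    hGB.comp x (E4.axialRotation α).hasFDerivAt
  have h' : HasFDerivAt (fun x' : E4 ↦ fderiv ℝ G (E4.axialRotation α x') (E4.axialRotation α w))
      (((fderiv ℝ (fderiv ℝ G) (E4.axialRotation α x)).comp (E4.axialRotation α)).flip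
        (E4.axialRotation α w)) x := by
    simpa using hcomp.clm_apply (hasFDerivAt_const (E4.axialRotation α w) x)
  rw [h'.fderiv, ContinuousLinearMap.flip_apply, ContinuousLinearMap.comp_apply]

/-! ### Continuity and smoothness of orbit maps (componentwise, avoiding costly unification) -/

/-- The orbit map `α ↦ R_α x` is smooth. [folklore] -/
theorem contDiff_axialRotation_apply (x : E4) {n : WithTop ℕ∞} :
    ContDiff ℝ n fun α : ℝ ↦ E4.axialRotation α x := by
  have h : ∀ α : ℝ, E4.axialRotation α x = WithLp.toLp 2 ![x 0,
      Real.cos α * x 1 - Real.sin α * x 2, Real.sin α * x 1 + Real.cos α * x 2, x 3] := fun α ↦ rfl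
  simp only [h]
  rw [contDiff_euclidean]
  intro i
  fin_cases i
  · simpa using contDiff_const (c := x 0)
  · have h : ContDiff ℝ n fun α : ℝ ↦ Real.cos α * x 1 - Real.sin α * x 2 :=
      (Real.contDiff_cos.mul contDiff_const).sub (Real.contDiff_sin.mul contDiff_const)
    simpa using h
  · have h : ContDiff ℝ n fun α : ℝ ↦ Real.sin α * x 1 + Real.cos α * x 2 :=
      (Real.contDiff_sin.mul contDiff_const).add (Real.contDiff_cos.mul contDiff_const)
    simpa using h
  · simpa using contDiff_const (c := x 3)

/-- The orbit map `α ↦ R_α x` is continuous. [folklore] -/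
theorem continuous_axialRotation_apply (x : E4) : Continuous fun α : ℝ ↦ E4.axialRotation α x :=
  (contDiff_axialRotation_apply x (n := 0)).continuous

/-- Continuity in `α` of `D²G(R_α x)(R_α u, R_α w)` for `G` smooth. [folklore] -/
theorem continuous_fderiv_fderiv_orbit {G : E4 → ℝ} (hG : ContDiff ℝ ∞ G) (x u w : E4) :
    Continuous fun α : ℝ ↦
      fderiv ℝ (fderiv ℝ G) (E4.axialRotation α x) (E4.axialRotation α u) (E4.axialRotation α w) := by
  have hB : Continuous (fderiv ℝ (fderiv ℝ G)) :=
    (hG.fderiv_right (m := ∞) le_rfl).continuous_fderiv (WithTop.coe_ne_zero.mpr ENat.top_ne_zero)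
  exact ((hB.comp (continuous_axialRotation_apply x)).clm_apply
    (continuous_axialRotation_apply u)).clm_apply (continuous_axialRotation_apply w)

/-- Continuity in `α` of `DG(R_α x)(R_α w)` for `G` smooth. [folklore] -/
theorem continuous_fderiv_orbit {G : E4 → ℝ} (hG : ContDiff ℝ ∞ G) (x w : E4) :
    Continuous fun α : ℝ ↦ fderiv ℝ G (E4.axialRotation α x) (E4.axialRotation α w) := by
  have hL : Continuous (fderiv ℝ G) := hG.continuous_fderiv (WithTop.coe_ne_zero.mpr ENat.top_ne_zero)
  exact (hL.comp (continuous_axialRotation_apply x)).clm_apply (continuous_axialRotation_apply w)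

/-! ### The wave operator annihilates the average of a solution -/

/-- Derivatives of two functions that agree on an open set agree there. [folklore] -/
theorem fderiv_eq_of_eqOn_isOpen {F : Type*} [NormedAddCommGroup F] [NormedSpace ℝ F]
    {f g : E4 → F} {N : Set E4} (hN : IsOpen N) (h : EqOn f g N) {z : E4} (hz : z ∈ N) :
    fderiv ℝ f z = fderiv ℝ g z :=
  (Filter.eventuallyEq_of_mem (hN.mem_nhds hz) h).fderiv_eq

/-- Second derivatives of two functions that agree on an open set agree there. [folklore] -/
theorem fderiv_fderiv_eq_of_eqOn_isOpen {f g : E4 → ℝ} {N : Set E4} (hN : IsOpen N)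
    (h : EqOn f g N) {z : E4} (hz : z ∈ N) :
    fderiv ℝ (fderiv ℝ f) z = fderiv ℝ (fderiv ℝ g) z :=
  fderiv_eq_of_eqOn_isOpen hN (fun _ hy ↦ fderiv_eq_of_eqOn_isOpen hN h hy) hz

/-- **The coordinate wave operator of the average is the average of the wave operator.** For `G`
smooth and `x` with `r(x) > 0`, with `Ψ₀ = ∫₀^{2π} G ∘ R_α dα`:
`∑ g^{μν}(x) ∂_μ∂_ν Ψ₀(x) + ∑ c^ν(x) ∂_ν Ψ₀(x)
   = ∫₀^{2π} (∑ g^{μν}(R_α x) ∂_μ∂_ν G(R_α x) + ∑ c^ν(R_α x) ∂_ν G(R_α x)) dα`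
(derivatives under the integral sign, then equivariance of `g⁻¹` and of `c = ∑ ∂_μ g^{μν} ∂_ν`).
O'Neill 1995, Ch. 2, §2.2 (`∂_φ` is Killing, so its flow commutes with `□_g`).
[cite: ONeill1995, Ch. 2 §2.2] -/
theorem waveCoord_rotAverage (M a : ℝ) {G : E4 → ℝ} (hG : ContDiff ℝ ∞ G) {x : E4}
    (hx : 0 < Kerr.radius a x) :
    ∑ μ, ∑ ν, Kerr.inverseMetric M a x μ ν *
        fderiv ℝ (fderiv ℝ (rotAverage G)) x (E4.basisVector μ) (E4.basisVector ν) +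
      ∑ ν, Kerr.divInverseMetric M a x ν * fderiv ℝ (rotAverage G) x (E4.basisVector ν) =
    ∫ α in (0 : ℝ)..2 * Real.pi,
      (∑ μ, ∑ ν, Kerr.inverseMetric M a (E4.axialRotation α x) μ ν *
          fderiv ℝ (fderiv ℝ G) (E4.axialRotation α x) (E4.basisVector μ) (E4.basisVector ν) +
        ∑ ν, Kerr.divInverseMetric M a (E4.axialRotation α x) ν *
          fderiv ℝ G (E4.axialRotation α x) (E4.basisVector ν)) := by
  -- derivatives under the integral sign
  simp only [fderiv_fderiv_rotAverage_apply hG, fderiv_rotAverage_apply hG]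
  -- integrability of the pieces (continuity in `α`)
  have hc2 : ∀ μ ν, Continuous fun α : ℝ ↦ fderiv ℝ (fderiv ℝ G) (E4.axialRotation α x)
      (E4.axialRotation α (E4.basisVector μ)) (E4.axialRotation α (E4.basisVector ν)) := fun μ ν ↦
    continuous_fderiv_fderiv_orbit hG x _ _
  have hc1 : ∀ ν, Continuous fun α : ℝ ↦ fderiv ℝ G (E4.axialRotation α x)
      (E4.axialRotation α (E4.basisVector ν)) := fun ν ↦ continuous_fderiv_orbit hG x _
  have hi2 : ∀ μ ν, IntervalIntegrable (fun α : ℝ ↦ Kerr.inverseMetric M a x μ ν *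
      fderiv ℝ (fderiv ℝ G) (E4.axialRotation α x)
        (E4.axialRotation α (E4.basisVector μ)) (E4.axialRotation α (E4.basisVector ν)))
      volume 0 (2 * Real.pi) := fun μ ν ↦ (continuous_const.mul (hc2 μ ν)).intervalIntegrable _ _
  have hi2s : ∀ μ, IntervalIntegrable (fun α : ℝ ↦ ∑ ν, Kerr.inverseMetric M a x μ ν *
      fderiv ℝ (fderiv ℝ G) (E4.axialRotation α x)
        (E4.axialRotation α (E4.basisVector μ)) (E4.axialRotation α (E4.basisVector ν)))
      volume 0 (2 * Real.pi) := fun μ ↦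
    (continuous_finsetSum _ fun ν _ ↦ continuous_const.mul (hc2 μ ν)).intervalIntegrable _ _
  have hA : IntervalIntegrable (fun α : ℝ ↦ ∑ μ, ∑ ν, Kerr.inverseMetric M a x μ ν *
      fderiv ℝ (fderiv ℝ G) (E4.axialRotation α x)
        (E4.axialRotation α (E4.basisVector μ)) (E4.axialRotation α (E4.basisVector ν)))
      volume 0 (2 * Real.pi) :=
    (continuous_finsetSum _ fun μ _ ↦ continuous_finsetSum _ fun ν _ ↦
      continuous_const.mul (hc2 μ ν)).intervalIntegrable _ _
  have hi1 : ∀ ν, IntervalIntegrable (fun α : ℝ ↦ Kerr.divInverseMetric M a x ν *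
      fderiv ℝ G (E4.axialRotation α x) (E4.axialRotation α (E4.basisVector ν))) volume 0 (2 * Real.pi) :=
    fun ν ↦ (continuous_const.mul (hc1 ν)).intervalIntegrable _ _
  have hB : IntervalIntegrable (fun α : ℝ ↦ ∑ ν, Kerr.divInverseMetric M a x ν *
      fderiv ℝ G (E4.axialRotation α x) (E4.axialRotation α (E4.basisVector ν))) volume 0 (2 * Real.pi) :=
    (continuous_finsetSum _ fun ν _ ↦ continuous_const.mul (hc1 ν)).intervalIntegrable _ _
  -- pull the finite sums and the constants inside the integrals
  have hsec : ∑ μ, ∑ ν, Kerr.inverseMetric M a x μ ν *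
      ∫ α in (0 : ℝ)..2 * Real.pi, fderiv ℝ (fderiv ℝ G) (E4.axialRotation α x)
        (E4.axialRotation α (E4.basisVector μ)) (E4.axialRotation α (E4.basisVector ν)) =
      ∫ α in (0 : ℝ)..2 * Real.pi, ∑ μ, ∑ ν, Kerr.inverseMetric M a x μ ν *
        fderiv ℝ (fderiv ℝ G) (E4.axialRotation α x)
          (E4.axialRotation α (E4.basisVector μ)) (E4.axialRotation α (E4.basisVector ν)) := by
    rw [intervalIntegral.integral_finsetSum (f := fun μ α ↦ ∑ ν, Kerr.inverseMetric M a x μ ν *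
      fderiv ℝ (fderiv ℝ G) (E4.axialRotation α x)
        (E4.axialRotation α (E4.basisVector μ)) (E4.axialRotation α (E4.basisVector ν)))
      fun μ _ ↦ hi2s μ]
    refine Finset.sum_congr rfl fun μ _ ↦ ?_
    rw [intervalIntegral.integral_finsetSum (f := fun ν α ↦ Kerr.inverseMetric M a x μ ν *
      fderiv ℝ (fderiv ℝ G) (E4.axialRotation α x)
        (E4.axialRotation α (E4.basisVector μ)) (E4.axialRotation α (E4.basisVector ν)))
      fun ν _ ↦ hi2 μ ν]
    exact Finset.sum_congr rfl fun ν _ ↦ (intervalIntegral.integral_const_mul _ _).symm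
  have hfir : ∑ ν, Kerr.divInverseMetric M a x ν *
      ∫ α in (0 : ℝ)..2 * Real.pi, fderiv ℝ G (E4.axialRotation α x)
        (E4.axialRotation α (E4.basisVector ν)) =
      ∫ α in (0 : ℝ)..2 * Real.pi, ∑ ν, Kerr.divInverseMetric M a x ν *
        fderiv ℝ G (E4.axialRotation α x) (E4.axialRotation α (E4.basisVector ν)) := by
    rw [intervalIntegral.integral_finsetSum (f := fun ν α ↦ Kerr.divInverseMetric M a x ν *
      fderiv ℝ G (E4.axialRotation α x) (E4.axialRotation α (E4.basisVector ν))) fun ν _ ↦ hi1 ν]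
    exact Finset.sum_congr rfl fun ν _ ↦ (intervalIntegral.integral_const_mul _ _).symm
  rw [hsec, hfir, ← intervalIntegral.integral_add hA hB]
  refine intervalIntegral.integral_congr fun α _ ↦ ?_
  -- pointwise in `α`: equivariance
  congr 1
  · exact (Kerr.sum_inverseMetric_axialRotation M a α x (fderiv ℝ (fderiv ℝ G) (E4.axialRotation α x))).symm
  · -- `∑ c^ν(x) DG(Rx)(R ∂_ν) = DG(Rx)(R c(x)) = DG(Rx)(c(Rx))`
    have h1 : ∑ ν, Kerr.divInverseMetric M a x ν *
        fderiv ℝ G (E4.axialRotation α x) (E4.axialRotation α (E4.basisVector ν)) =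
        fderiv ℝ G (E4.axialRotation α x)
          (E4.axialRotation α (∑ ν, Kerr.divInverseMetric M a x ν • E4.basisVector ν)) := by
      rw [map_sum, map_sum]
      exact Finset.sum_congr rfl fun ν _ ↦ by rw [map_smul, map_smul, smul_eq_mul]
    have h2 : ∑ ν, Kerr.divInverseMetric M a (E4.axialRotation α x) ν *
        fderiv ℝ G (E4.axialRotation α x) (E4.basisVector ν) =
        fderiv ℝ G (E4.axialRotation α x)
          (∑ ν, Kerr.divInverseMetric M a (E4.axialRotation α x) ν • E4.basisVector ν) := by
      rw [map_sum]
      exact Finset.sum_congr rfl fun ν _ ↦ by rw [map_smul, smul_eq_mul]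
    rw [h1, h2, Kerr.sum_divInverseMetric_axialRotation M a α hx]

/-- **The average of a solution is a solution.** Let `ψ` be `C^∞` on the open set `U` of the chart
with `□_g ψ = 0` on `U`, `G` a smooth function on `E4` agreeing with the representative
`extend ψ 0` on an open set `N` whose points lie over `U`, and `x` a point of the chart whose whole
orbit lies in `N`. Then the function `y ↦ ∫₀^{2π} G(R_α y) dα` on the chart satisfies `□_g = 0` at
`x`. Aretakis, ATMP 19 (2015), before Thm. 3 ("projecting to the zeroth azimuthal frequency").
[cite: Aretakis2015, §5.2] -/
theorem dalembertian_rotAverage_eq_zero [Kerr.Facts] [Kerr.SliceFacts] {M r₀ : ℝ}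
    {U : Set (Kerr.region M r₀)} {ψ : Kerr.region M r₀ → ℝ} (hU : IsOpen U)
    (hψ : ContMDiffOn 𝓘(ℝ, E4) 𝓘(ℝ, ℝ) ∞ ψ U)
    (hsol : ∀ x ∈ U, (Kerr.smoothMetric M M r₀).toPseudoRiemannianMetric.dalembertian ψ x = 0)
    {G : E4 → ℝ} (hG : ContDiff ℝ ∞ G) {N : Set E4} (hN : IsOpen N)
    (hNU : ∀ z ∈ N, ∃ hz : z ∈ Kerr.region M r₀, (⟨z, hz⟩ : Kerr.region M r₀) ∈ U)
    (hGN : EqOn G (Function.extend Subtype.val ψ 0) N)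
    (x : Kerr.region M r₀) (hx : ∀ α, E4.axialRotation α x ∈ N) :
    (Kerr.smoothMetric M M r₀).toPseudoRiemannianMetric.dalembertian
      (fun y : Kerr.region M r₀ ↦ rotAverage G y) x = 0 := by
  set Ψ : E4 → ℝ := Function.extend Subtype.val ψ 0 with hΨdef
  have hrep : ∀ y : Kerr.region M r₀, ψ y = Ψ y := Kerr.extend_apply_coe ψ
  have hΨ₀ : ContDiff ℝ ∞ (rotAverage G) := contDiff_rotAverage hG
  have hxpos : 0 < Kerr.radius M x := Kerr.radius_pos_of_mem_region x.2
  rw [dalembertian_eq_hessian_add_firstOrder M M r₀ (ψ := fun y : Kerr.region M r₀ ↦ rotAverage G y)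
    (Φ := rotAverage G) (fun _ ↦ rfl) x (hΨ₀.contDiffAt.of_le (WithTop.coe_le_coe.mpr le_top)),
    waveCoord_rotAverage M M hG hxpos]
  refine intervalIntegral.integral_zero_ae (Eventually.of_forall fun α _ ↦ ?_)
  -- at the point `R_α x ∈ N` over `U`: replace `G` by `Ψ` and recognise `□ψ`
  obtain ⟨hz, hzU⟩ := hNU _ (hx α)
  have hΨz : ContDiffAt ℝ 2 Ψ (E4.axialRotation α x) := by
    have h := (OpensChart.contMDiffAt_iff ⟨_, hz⟩ ψ Ψ hrep).mp (hψ.contMDiffAt (hU.mem_nhds hzU))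
    exact h.of_le (WithTop.coe_le_coe.mpr le_top)
  have h := hsol _ hzU
  rw [dalembertian_eq_hessian_add_firstOrder M M r₀ hrep ⟨_, hz⟩ hΨz] at h
  rw [fderiv_fderiv_eq_of_eqOn_isOpen hN hGN (hx α), fderiv_eq_of_eqOn_isOpen hN hGN (hx α)]
  exact h

/-! ### The average on the invariant set: values, derivatives, axisymmetry -/

/-- On points whose orbit lies in the set where `G = Ψ`, the average of `G` is the orbit integral of
`Ψ`. [folklore] -/
theorem rotAverage_apply_of_forall_mem {G Ψ : E4 → ℝ} {N : Set E4} (hGN : EqOn G Ψ N) {x : E4}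
    (hx : ∀ α, E4.axialRotation α x ∈ N) :
    rotAverage G x = ∫ α in (0 : ℝ)..2 * Real.pi, Ψ (E4.axialRotation α x) :=
  intervalIntegral.integral_congr fun α _ ↦ hGN (hx α)

/-- On such points the derivative of the average is the orbit integral of the derivative of `Ψ`.
[folklore] -/
theorem fderiv_rotAverage_apply_of_forall_mem {G Ψ : E4 → ℝ} (hG : ContDiff ℝ ∞ G) {N : Set E4}
    (hN : IsOpen N) (hGN : EqOn G Ψ N) {x : E4} (hx : ∀ α, E4.axialRotation α x ∈ N) (v : E4) :
    fderiv ℝ (rotAverage G) x v =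
      ∫ α in (0 : ℝ)..2 * Real.pi, fderiv ℝ Ψ (E4.axialRotation α x) (E4.axialRotation α v) := by
  rw [fderiv_rotAverage_apply hG]
  exact intervalIntegral.integral_congr fun α _ ↦ by rw [fderiv_eq_of_eqOn_isOpen hN hGN (hx α)]

/-- **The average is axisymmetric**: `Ψ₀(R_β x) = Ψ₀(x)` (substitute `α ↦ α + β` and use the
`2π`-periodicity of the orbit). Aretakis, JFA 263 (2012), §3 (axisymmetric functions).
[cite: Aretakis2012, §3 (axisymmetric solutions)] -/
theorem rotAverage_axialRotation (G : E4 → ℝ) (β : ℝ) (x : E4) :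
    rotAverage G (E4.axialRotation β x) = rotAverage G x := by
  unfold rotAverage
  have hper : Function.Periodic (fun α ↦ G (E4.axialRotation α x)) (2 * Real.pi) := fun α ↦ by
    simp only [axialRotation_add_two_pi]
  calc ∫ α in (0 : ℝ)..2 * Real.pi, G (E4.axialRotation α (E4.axialRotation β x))
      = ∫ α in (0 : ℝ)..2 * Real.pi, G (E4.axialRotation (α + β) x) := by
        refine intervalIntegral.integral_congr fun α _ ↦ ?_
        simp only [E4.axialRotation_add_apply]
    _ = ∫ α in (0 : ℝ) + β..2 * Real.pi + β, G (E4.axialRotation α x) := by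
        rw [intervalIntegral.integral_comp_add_right (fun α ↦ G (E4.axialRotation α x)) β]
    _ = ∫ α in β..β + 2 * Real.pi, G (E4.axialRotation α x) := by rw [zero_add, add_comm]
    _ = ∫ α in (0 : ℝ)..0 + 2 * Real.pi, G (E4.axialRotation α x) := hper.intervalIntegral_add_eq β 0
    _ = ∫ α in (0 : ℝ)..2 * Real.pi, G (E4.axialRotation α x) := by rw [zero_add]

/-! ### The charge of the average: `H₀[ψ₀] = 2π H₀[ψ]` -/

/-- The charge density is `2π`-periodic in `φ`. [folklore] -/
theorem densityFun_add_two_pi (M : ℝ) (Ψ : E4 → ℝ) (σ θ φ : ℝ) :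
    densityFun M Ψ σ θ (φ + 2 * Real.pi) = densityFun M Ψ σ θ φ := by
  simp only [densityFun, horizonPoint_add_two_pi]

/-- **The density of the average is the orbit integral of the density.** For `G` smooth agreeing
with `Ψ` on an open set `N` containing the orbits of the horizon points, and `M > 0`:
`density[Ψ₀](σ, θ, φ) = ∫₀^{2π} density[Ψ](σ, θ, φ + α) dα` (`R_α ∂_{t*} = ∂_{t*}`,
`ℓ♯(R_α p) = R_α ℓ♯(p)`, `R_α p_σ(θ, φ) = p_σ(θ, φ + α)`), provided the three pieces of the
density are continuous along the sphere. [cite: Aretakis2015, §5.2] -/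
theorem densityFun_rotAverage {M : ℝ} (hM : 0 < M) {G Ψ : E4 → ℝ} (hG : ContDiff ℝ ∞ G) {N : Set E4}
    (hN : IsOpen N) (hGN : EqOn G Ψ N) {σ θ φ : ℝ} (hx : ∀ α, horizonPoint M σ θ (φ + α) ∈ N)
    (hc0 : Continuous fun β : ℝ ↦ Ψ (horizonPoint M σ θ β))
    (hcT : Continuous fun β : ℝ ↦ fderiv ℝ Ψ (horizonPoint M σ θ β) (E4.basisVector 0))
    (hcY : Continuous fun β : ℝ ↦ fderiv ℝ Ψ (horizonPoint M σ θ β) (horizonNull θ β)) :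
    densityFun M (rotAverage G) σ θ φ =
      ∫ α in (0 : ℝ)..2 * Real.pi, densityFun M Ψ σ θ (φ + α) := by
  have hx' : ∀ α, E4.axialRotation α (horizonPoint M σ θ φ) ∈ N := fun α ↦ by
    rw [axialRotation_horizonPoint]; exact hx α
  have hval : rotAverage G (horizonPoint M σ θ φ) =
      ∫ α in (0 : ℝ)..2 * Real.pi, Ψ (horizonPoint M σ θ (φ + α)) := by
    rw [rotAverage_apply_of_forall_mem hGN hx']
    simp only [axialRotation_horizonPoint]
  have hT : fderiv ℝ (rotAverage G) (horizonPoint M σ θ φ) (E4.basisVector 0) =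
      ∫ α in (0 : ℝ)..2 * Real.pi, fderiv ℝ Ψ (horizonPoint M σ θ (φ + α)) (E4.basisVector 0) := by
    rw [fderiv_rotAverage_apply_of_forall_mem hG hN hGN hx']
    simp only [axialRotation_horizonPoint, E4.axialRotation_basisVector_zero]
  have hY : fderiv ℝ (rotAverage G) (horizonPoint M σ θ φ)
      (Kerr.nullVector M (horizonPoint M σ θ φ)) =
      ∫ α in (0 : ℝ)..2 * Real.pi, fderiv ℝ Ψ (horizonPoint M σ θ (φ + α)) (horizonNull θ (φ + α)) := by
    rw [fderiv_rotAverage_apply_of_forall_mem hG hN hGN hx']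
    refine intervalIntegral.integral_congr fun α _ ↦ ?_
    show fderiv ℝ Ψ (E4.axialRotation α (horizonPoint M σ θ φ))
        (E4.axialRotation α (Kerr.nullVector M (horizonPoint M σ θ φ))) = _
    rw [← Kerr.nullVector_axialRotation, axialRotation_horizonPoint, nullVector_horizonPoint hM]
  -- assemble by linearity of the integral
  have h1 : IntervalIntegrable (fun α ↦ Ψ (horizonPoint M σ θ (φ + α))) volume 0 (2 * Real.pi) :=
    (hc0.comp (continuous_const.add continuous_id)).intervalIntegrable _ _
  have h2 : IntervalIntegrable (fun α ↦ fderiv ℝ Ψ (horizonPoint M σ θ (φ + α)) (E4.basisVector 0))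
      volume 0 (2 * Real.pi) := (hcT.comp (continuous_const.add continuous_id)).intervalIntegrable _ _
  have h3 : IntervalIntegrable (fun α ↦ fderiv ℝ Ψ (horizonPoint M σ θ (φ + α)) (horizonNull θ (φ + α)))
      volume 0 (2 * Real.pi) := (hcY.comp (continuous_const.add continuous_id)).intervalIntegrable _ _
  have hdens : ∀ α, densityFun M Ψ σ θ (φ + α) =
      (M * Real.sin θ ^ 2 * fderiv ℝ Ψ (horizonPoint M σ θ (φ + α)) (E4.basisVector 0) +
        4 * M * fderiv ℝ Ψ (horizonPoint M σ θ (φ + α)) (horizonNull θ (φ + α)) +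
        2 * Ψ (horizonPoint M σ θ (φ + α))) * (2 * M ^ 2 * Real.sin θ) := fun α ↦ by
    rw [densityFun, nullVector_horizonPoint hM]
  simp only [hdens]
  rw [densityFun, hval, hT, hY, intervalIntegral.integral_mul_const,
    intervalIntegral.integral_add ((h2.const_mul _).add (h3.const_mul _)) (h1.const_mul _),
    intervalIntegral.integral_add (h2.const_mul _) (h3.const_mul _),
    intervalIntegral.integral_const_mul, intervalIntegral.integral_const_mul,
    intervalIntegral.integral_const_mul]

/-- **A shifted `2π`-periodic function has the same integral over a period.** [folklore] -/
theorem intervalIntegral_comp_add_of_periodic {g : ℝ → ℝ} (hg : Function.Periodic g (2 * Real.pi))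
    (φ : ℝ) : ∫ α in (0 : ℝ)..2 * Real.pi, g (φ + α) = ∫ β in (0 : ℝ)..2 * Real.pi, g β := by
  calc ∫ α in (0 : ℝ)..2 * Real.pi, g (φ + α)
      = ∫ α in (0 : ℝ)..2 * Real.pi, g (α + φ) := by
        refine intervalIntegral.integral_congr fun α _ ↦ ?_
        rw [add_comm]
    _ = ∫ β in (0 : ℝ) + φ..2 * Real.pi + φ, g β := by rw [intervalIntegral.integral_comp_add_right g φ]
    _ = ∫ β in φ..φ + 2 * Real.pi, g β := by rw [zero_add, add_comm]
    _ = ∫ β in (0 : ℝ)..0 + 2 * Real.pi, g β := hg.intervalIntegral_add_eq φ 0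
    _ = ∫ β in (0 : ℝ)..2 * Real.pi, g β := by rw [zero_add]

/-- **The sphere integral of the averaged density is `2π` times that of the density**, given
the pointwise formula `density[Ψ₀](θ, φ) = ∫₀^{2π} density[Ψ](θ, φ + α) dα` and joint continuity of
the density in the angles: `∫∫ density[Ψ₀] = 2π ∫∫ density[Ψ]` (Fubini in `(θ, α)`, then the
`φ`-integral of the shifted `2π`-periodic function `β ↦ ∫ density[Ψ](θ, β) dθ`). [cite: Aretakis2015, §5.2] -/
theorem sphereIntegral_of_orbitIntegral {D₀ D : ℝ → ℝ → ℝ}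
    (hD₀ : ∀ θ φ, D₀ θ φ = ∫ α in (0 : ℝ)..2 * Real.pi, D θ (φ + α))
    (hDc : Continuous (Function.uncurry D)) (hper : ∀ θ φ, D θ (φ + 2 * Real.pi) = D θ φ) :
    ∫ φ in (0 : ℝ)..2 * Real.pi, ∫ θ in (0 : ℝ)..Real.pi, D₀ θ φ =
      2 * Real.pi * ∫ φ in (0 : ℝ)..2 * Real.pi, ∫ θ in (0 : ℝ)..Real.pi, D θ φ := by
  have hπ : (0 : ℝ) ≤ Real.pi := Real.pi_pos.le
  have h2π : (0 : ℝ) ≤ 2 * Real.pi := by positivity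
  -- for each `φ`: swap `θ` and `α`, then use periodicity in `β = φ + α`
  have hg : Continuous fun β ↦ ∫ θ in (0 : ℝ)..Real.pi, D θ β := by
    have h : Continuous (Function.uncurry fun β θ ↦ D θ β) := hDc.comp (continuous_snd.prodMk continuous_fst)
    exact intervalIntegral.continuous_parametric_intervalIntegral_of_continuous' h 0 Real.pi
  have hgper : Function.Periodic (fun β ↦ ∫ θ in (0 : ℝ)..Real.pi, D θ β) (2 * Real.pi) := fun β ↦ by
    simp only [hper]
  have hinner : ∀ φ, ∫ θ in (0 : ℝ)..Real.pi, D₀ θ φ = ∫ β in (0 : ℝ)..2 * Real.pi, ∫ θ in (0 : ℝ)..Real.pi, D θ β := by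
    intro φ
    simp only [hD₀]
    have hc : Continuous (Function.uncurry fun θ α ↦ D θ (φ + α)) :=
      hDc.comp (continuous_fst.prodMk (continuous_const.add continuous_snd))
    rw [intervalIntegral_swap_of_continuous hc hπ h2π]
    exact intervalIntegral_comp_add_of_periodic hgper φ
  simp only [hinner, intervalIntegral.integral_const, sub_zero, smul_eq_mul]

/-! ### Transversal derivatives of the average -/

/-- **The transversal derivative of a smooth function with support inside the chart is smooth**:
`w ↦ DG(w)(ℓ♯_w)` is `C^∞` on `E4` when `tsupport G` lies in a set on which `r > 0` (where `ℓ♯`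
is smooth); off `tsupport G` the function vanishes identically. [folklore] -/
theorem contDiff_transversalFun {a : ℝ} {G : E4 → ℝ} (hG : ContDiff ℝ ∞ G) {V : Set E4}
    (hsupp : tsupport G ⊆ V) (hV : ∀ z ∈ V, 0 < Kerr.radius a z) :
    ContDiff ℝ ∞ fun w ↦ fderiv ℝ G w (Kerr.nullVector a w) := by
  rw [contDiff_iff_contDiffAt]
  intro w
  by_cases hw : w ∈ tsupport G
  · exact (hG.fderiv_right (m := ∞) le_rfl).contDiffAt.clm_apply
      (Kerr.contDiffAt_nullVector a (hV w (hsupp hw)))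
  · have hev : (fun w' ↦ fderiv ℝ G w' (Kerr.nullVector a w')) =ᶠ[𝓝 w] fun _ ↦ 0 := by
      filter_upwards [(isClosed_tsupport G).isOpen_compl.mem_nhds hw] with w' hw'
      rw [fderiv_of_notMem_tsupport ℝ hw', _root_.zero_apply]
    exact (contDiffAt_const (c := (0 : ℝ))).congr_of_eventuallyEq hev

/-- The support of the transversal derivative lies in that of the function. [folklore] -/
theorem tsupport_transversalFun_subset {a : ℝ} (G : E4 → ℝ) :
    tsupport (fun w ↦ fderiv ℝ G w (Kerr.nullVector a w)) ⊆ tsupport G := by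
  refine (closure_mono fun w hw ↦ ?_).trans (tsupport_fderiv_subset ℝ)
  intro h
  exact hw (by simp [Function.mem_support, h] at *)

/-- **The transversal derivative of a function with a global differentiable representative** on the
chart is that representative's derivative along `ℓ♯`, at every point. [folklore] -/
theorem transversalDeriv_of_rep {M r₀ : ℝ} {Φ : E4 → ℝ} (hΦ : Differentiable ℝ Φ)
    (x : Kerr.region M r₀) :
    transversalDeriv M r₀ (fun y : Kerr.region M r₀ ↦ Φ y) x = fderiv ℝ Φ x (Kerr.nullVector M x) := by
  rw [transversalDeriv_apply, OpensChart.mfderiv_eq x (fun y : Kerr.region M r₀ ↦ Φ y) Φ (fun _ ↦ rfl) (hΦ _)]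
  rfl

/-- **`Y(∫ G∘R_α) = ∫ (YG)∘R_α`** on the whole coordinate space: the derivative along `ℓ♯` of the
average is the average of `w ↦ DG(w)(ℓ♯_w)` (derivative under the integral sign and
`R_α ℓ♯(x) = ℓ♯(R_α x)`). [cite: Aretakis2015, §5.2] -/
theorem fderiv_rotAverage_nullVector {a : ℝ} {G : E4 → ℝ} (hG : ContDiff ℝ ∞ G) (x : E4) :
    fderiv ℝ (rotAverage G) x (Kerr.nullVector a x) =
      rotAverage (fun w ↦ fderiv ℝ G w (Kerr.nullVector a w)) x := by
  rw [fderiv_rotAverage_apply hG, rotAverage]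
  exact intervalIntegral.integral_congr fun α _ ↦ by rw [Kerr.nullVector_axialRotation]

/-- **The transversal derivative of the average is the orbit integral of the transversal
derivative.** Let `ψ` be smooth on the open `U`, `G` smooth on `E4` agreeing with `extend ψ 0` on an
open `N` lying over `U`, and `x` a chart point with orbit in `N`; then
`Y(∫ G∘R_α)(x) = ∫₀^{2π} (Yψ)(R_α x) dα` (`Y = Kerr.transversalDeriv`). Aretakis, ATMP 19 (2015),
§5.2 (`Y` commutes with `Φ`). [cite: Aretakis2015, §5.2] -/
theorem transversalDeriv_rotAverage_eq_orbitIntegral {M r₀ : ℝ} {U : Set (Kerr.region M r₀)}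
    {ψ : Kerr.region M r₀ → ℝ} (hU : IsOpen U) (hψ : ContMDiffOn 𝓘(ℝ, E4) 𝓘(ℝ, ℝ) ∞ ψ U)
    {G : E4 → ℝ} (hG : ContDiff ℝ ∞ G) {N : Set E4} (hN : IsOpen N)
    (hNU : ∀ z ∈ N, ∃ hz : z ∈ Kerr.region M r₀, (⟨z, hz⟩ : Kerr.region M r₀) ∈ U)
    (hGN : EqOn G (Function.extend Subtype.val ψ 0) N)
    (x : Kerr.region M r₀) (hx : ∀ α, E4.axialRotation α x ∈ N) :
    transversalDeriv M r₀ (fun y : Kerr.region M r₀ ↦ rotAverage G y) x =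
      ∫ α in (0 : ℝ)..2 * Real.pi, transversalDeriv M r₀ ψ (Kerr.axialRotate M r₀ α x) := by
  set Ψ : E4 → ℝ := Function.extend Subtype.val ψ 0 with hΨdef
  have hrep : ∀ y : Kerr.region M r₀, ψ y = Ψ y := Kerr.extend_apply_coe ψ
  rw [transversalDeriv_of_rep ((contDiff_rotAverage hG).differentiable (WithTop.coe_ne_zero.mpr ENat.top_ne_zero)) x,
    fderiv_rotAverage_nullVector hG, rotAverage]
  refine intervalIntegral.integral_congr fun α _ ↦ ?_
  obtain ⟨hz, hzU⟩ := hNU _ (hx α)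
  have hΨd : DifferentiableAt ℝ Ψ (E4.axialRotation α x) := by
    have h := (OpensChart.contMDiffAt_iff ⟨_, hz⟩ ψ Ψ hrep).mp (hψ.contMDiffAt (hU.mem_nhds hzU))
    exact h.differentiableAt (WithTop.coe_ne_zero.mpr ENat.top_ne_zero)
  show fderiv ℝ G (E4.axialRotation α x) (Kerr.nullVector M (E4.axialRotation α x)) =
    transversalDeriv M r₀ ψ (Kerr.axialRotate M r₀ α x)
  rw [transversalDeriv_apply, Kerr.coe_axialRotate,
    OpensChart.mfderiv_eq (Kerr.axialRotate M r₀ α x) ψ Ψ hrep hΨd, Kerr.coe_axialRotate,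
    fderiv_eq_of_eqOn_isOpen hN hGN (hx α)]
  rfl

/-- **A smooth function on `U` has a smooth transversal derivative on `U`**, represented near `U` by
`z ↦ DΨ(z)(ℓ♯_z)`, `Ψ = extend ψ 0`. [folklore] -/
theorem contMDiffOn_transversalDeriv {M r₀ : ℝ} {U : Set (Kerr.region M r₀)} {ψ : Kerr.region M r₀ → ℝ}
    (hU : IsOpen U) (hψ : ContMDiffOn 𝓘(ℝ, E4) 𝓘(ℝ, ℝ) ∞ ψ U) :
    ContMDiffOn 𝓘(ℝ, E4) 𝓘(ℝ, ℝ) ∞ (transversalDeriv M r₀ ψ) U ∧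
      ∀ y ∈ U, transversalDeriv M r₀ ψ y =
        fderiv ℝ (Function.extend Subtype.val ψ 0) y (Kerr.nullVector M y) := by
  set Ψ : E4 → ℝ := Function.extend Subtype.val ψ 0 with hΨdef
  have hrep : ∀ y : Kerr.region M r₀, ψ y = Ψ y := Kerr.extend_apply_coe ψ
  have hΨ : ∀ y ∈ U, ContDiffAt ℝ ∞ Ψ y := fun y hy ↦
    (OpensChart.contMDiffAt_iff y ψ Ψ hrep).mp (hψ.contMDiffAt (hU.mem_nhds hy))
  have hval : ∀ y ∈ U, transversalDeriv M r₀ ψ y = fderiv ℝ Ψ y (Kerr.nullVector M y) := fun y hy ↦ by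
    rw [transversalDeriv_apply, OpensChart.mfderiv_eq y ψ Ψ hrep ((hΨ y hy).differentiableAt (WithTop.coe_ne_zero.mpr ENat.top_ne_zero))]
    rfl
  refine ⟨fun y hy ↦ ?_, hval⟩
  -- near `y ∈ U` the transversal derivative is the smooth function `z ↦ DΨ(z)(ℓ♯_z)` on the chart
  have hsm : ContMDiffAt 𝓘(ℝ, E4) 𝓘(ℝ, ℝ) ∞
      (fun y' : Kerr.region M r₀ ↦ fderiv ℝ Ψ y' (Kerr.nullVector M y')) y := by
    rw [OpensChart.contMDiffAt_iff y _ (fun z ↦ fderiv ℝ Ψ z (Kerr.nullVector M z)) (fun _ ↦ rfl)]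
    exact ((hΨ y hy).fderiv_right (m := ∞) le_rfl).clm_apply
      (Kerr.contDiffAt_nullVector M (Kerr.radius_pos_of_mem_region y.2))
  have hev : transversalDeriv M r₀ ψ =ᶠ[𝓝 y]
      fun y' : Kerr.region M r₀ ↦ fderiv ℝ Ψ y' (Kerr.nullVector M y') :=
    Filter.eventuallyEq_of_mem (hU.mem_nhds hy) fun y' hy' ↦ hval y' hy'
  exact (hsm.congr_of_eventuallyEq hev).contMDiffWithinAt

/-- **The second transversal derivative of the average is the orbit integral of the second
transversal derivative**: `YY(∫ G∘R_α)(x) = ∫₀^{2π} (YYψ)(R_α x) dα`, under the hypotheses of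
`transversalDeriv_rotAverage_eq_orbitIntegral` and `tsupport G ⊆ V` for an open `V` of the chart.
[cite: Aretakis2015, §5.2] -/
theorem transversalDeriv_transversalDeriv_rotAverage_eq_orbitIntegral {M r₀ : ℝ}
    {U : Set (Kerr.region M r₀)} {ψ : Kerr.region M r₀ → ℝ} (hU : IsOpen U)
    (hψ : ContMDiffOn 𝓘(ℝ, E4) 𝓘(ℝ, ℝ) ∞ ψ U)
    {G : E4 → ℝ} (hG : ContDiff ℝ ∞ G) {V : Set E4} (hsupp : tsupport G ⊆ V)
    (hV : ∀ z ∈ V, 0 < Kerr.radius M z) {N : Set E4} (hN : IsOpen N)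
    (hNU : ∀ z ∈ N, ∃ hz : z ∈ Kerr.region M r₀, (⟨z, hz⟩ : Kerr.region M r₀) ∈ U)
    (hGN : EqOn G (Function.extend Subtype.val ψ 0) N)
    (x : Kerr.region M r₀) (hx : ∀ α, E4.axialRotation α x ∈ N) :
    transversalDeriv M r₀ (transversalDeriv M r₀ (fun y : Kerr.region M r₀ ↦ rotAverage G y)) x =
      ∫ α in (0 : ℝ)..2 * Real.pi,
        transversalDeriv M r₀ (transversalDeriv M r₀ ψ) (Kerr.axialRotate M r₀ α x) := by
  set Ψ : E4 → ℝ := Function.extend Subtype.val ψ 0 with hΨdef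
  have hrep : ∀ y : Kerr.region M r₀, ψ y = Ψ y := Kerr.extend_apply_coe ψ
  set YG : E4 → ℝ := fun w ↦ fderiv ℝ G w (Kerr.nullVector M w) with hYG
  have hYGs : ContDiff ℝ ∞ YG := contDiff_transversalFun hG hsupp hV
  -- `Y ψ₀' = (rotAverage YG) ∘ val`
  have hY : transversalDeriv M r₀ (fun y : Kerr.region M r₀ ↦ rotAverage G y) =
      fun y : Kerr.region M r₀ ↦ rotAverage YG y := by
    funext y
    rw [transversalDeriv_of_rep ((contDiff_rotAverage hG).differentiable (WithTop.coe_ne_zero.mpr ENat.top_ne_zero)) y,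
      fderiv_rotAverage_nullVector hG]
  rw [hY]
  -- the transversal derivative of `ψ`, smooth on `U`, is represented on `N` by `YG`
  obtain ⟨hYψ, hYval⟩ := contMDiffOn_transversalDeriv hU hψ
  have hGN' : EqOn YG (Function.extend Subtype.val (transversalDeriv M r₀ ψ) 0) N := by
    intro z hz
    obtain ⟨hz', hzU⟩ := hNU z hz
    rw [← Kerr.extend_apply_coe (transversalDeriv M r₀ ψ) ⟨z, hz'⟩, hYval _ hzU]
    show fderiv ℝ G z (Kerr.nullVector M z) = fderiv ℝ Ψ z (Kerr.nullVector M z)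
    rw [fderiv_eq_of_eqOn_isOpen hN hGN hz]
  exact transversalDeriv_rotAverage_eq_orbitIntegral hU hYψ hYGs hN hNU hGN' x hx

/-! ### Closure of the class under `T = ∂_{t*}` (stationarity of the wave operator) -/

/-- `minSmoothness ℝ 2 ≤ ∞` (bookkeeping for the symmetry of second derivatives of smooth
functions). [folklore] -/
theorem minSmoothness_two_le_infty : minSmoothness ℝ 2 ≤ (∞ : WithTop ℕ∞) := by
  rw [minSmoothness_of_isRCLikeNormedField]
  exact WithTop.coe_le_coe.mpr le_top

/-- Evaluation of the derivative of an operator-valued function at fixed vectors: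
`D[y ↦ c(y) v](z) u = (Dc(z) u) v`. [folklore] -/
theorem fderiv_clm_apply_const_apply {F : Type*} [NormedAddCommGroup F] [NormedSpace ℝ F]
    {c : E4 → E4 →L[ℝ] F} {z : E4} (hc : DifferentiableAt ℝ c z) (v u : E4) :
    fderiv ℝ (fun y ↦ c y v) z u = fderiv ℝ c z u v := by
  have h' : HasFDerivAt (fun y ↦ c y v) ((fderiv ℝ c z).flip v) z := by
    simpa using hc.hasFDerivAt.clm_apply (hasFDerivAt_const v z)
  rw [h'.fderiv, ContinuousLinearMap.flip_apply]

/-- **Symmetry of third derivatives** of a smooth function: the slots of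
`D³Φ(z)(u)(v)(w) = fderiv (fderiv (fderiv Φ)) z u v w` may be permuted; here the cyclic form
`D³Φ(z)(u)(v)(w) = D³Φ(z)(w)(u)(v)` (from the symmetry of `D²Φ` at every point and of `D²(DΦ)` at
`z`). [folklore] -/
theorem fderiv_fderiv_fderiv_cyclic {Φ : E4 → ℝ} (hΦ : ContDiff ℝ ∞ Φ) (z u v w : E4) :
    fderiv ℝ (fderiv ℝ (fderiv ℝ Φ)) z u v w = fderiv ℝ (fderiv ℝ (fderiv ℝ Φ)) z w u v := by
  have h1 : ContDiff ℝ ∞ (fderiv ℝ Φ) := hΦ.fderiv_right (m := ∞) le_rfl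
  have h2 : ContDiff ℝ ∞ (fderiv ℝ (fderiv ℝ Φ)) := h1.fderiv_right (m := ∞) le_rfl
  have hd2 : Differentiable ℝ (fderiv ℝ (fderiv ℝ Φ)) := h2.differentiable (WithTop.coe_ne_zero.mpr ENat.top_ne_zero)
  -- (S2): swap of the last two slots, from the symmetry of `D²Φ` at every point
  have hS2 : ∀ a b c : E4, fderiv ℝ (fderiv ℝ (fderiv ℝ Φ)) z a b c =
      fderiv ℝ (fderiv ℝ (fderiv ℝ Φ)) z a c b := by
    intro a b c
    have hsym : (fun y ↦ fderiv ℝ (fderiv ℝ Φ) y b c) = fun y ↦ fderiv ℝ (fderiv ℝ Φ) y c b :=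
      funext fun y ↦ (hΦ.contDiffAt.isSymmSndFDerivAt minSmoothness_two_le_infty) b c
    have e1 : fderiv ℝ (fderiv ℝ (fderiv ℝ Φ)) z a b c =
        fderiv ℝ (fun y ↦ fderiv ℝ (fderiv ℝ Φ) y b c) z a := by
      rw [fderiv_clm_apply_const_apply (c := fun y ↦ fderiv ℝ (fderiv ℝ Φ) y b) ?_ c a,
        fderiv_clm_apply_const_apply (hd2 z) b a]
      exact ((hd2 z).hasFDerivAt.clm_apply (hasFDerivAt_const b z)).differentiableAt
    have e2 : fderiv ℝ (fderiv ℝ (fderiv ℝ Φ)) z a c b =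
        fderiv ℝ (fun y ↦ fderiv ℝ (fderiv ℝ Φ) y c b) z a := by
      rw [fderiv_clm_apply_const_apply (c := fun y ↦ fderiv ℝ (fderiv ℝ Φ) y c) ?_ b a,
        fderiv_clm_apply_const_apply (hd2 z) c a]
      exact ((hd2 z).hasFDerivAt.clm_apply (hasFDerivAt_const c z)).differentiableAt
    rw [e1, e2, hsym]
  -- (S1): swap of the first two slots, from the symmetry of `D²(DΦ)` at `z`
  have hS1 : ∀ a b c : E4, fderiv ℝ (fderiv ℝ (fderiv ℝ Φ)) z a b c =
      fderiv ℝ (fderiv ℝ (fderiv ℝ Φ)) z b a c := by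
    intro a b c
    have h := (h1.contDiffAt (x := z)).isSymmSndFDerivAt minSmoothness_two_le_infty a b
    rw [h]
  rw [hS1 w u v, hS2 u w v]

/-- The divergence coefficients `c^ν(y) = ∑ ∂_μ g^{μν}` are `C^n` where `r > 0` (explicit formula
`−(2M/Σ) ℓ^ν`). [cite: KerrSchild1965, §2] -/
theorem contDiffAt_divInverseMetric (M a : ℝ) {z : E4} (hz : 0 < Kerr.radius a z) (ν : Fin 4)
    {n : WithTop ℕ∞} : ContDiffAt ℝ n (fun y ↦ Kerr.divInverseMetric M a y ν) z := by
  have hopen : IsOpen {y : E4 | 0 < Kerr.radius a y} := isOpen_lt continuous_const (Kerr.continuous_radius a)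
  have hev : (fun y ↦ Kerr.divInverseMetric M a y ν) =ᶠ[𝓝 z]
      fun y ↦ -(2 * M / Kerr.blSigma a (E4.spatial y)) * Kerr.nullVector a y ν := by
    filter_upwards [hopen.mem_nhds hz] with y hy
    exact Kerr.divInverseMetric_eq M a hy ν
  refine ContDiffAt.congr_of_eventuallyEq ?_ hev
  have hS : ContDiffAt ℝ n (fun y ↦ Kerr.blSigma a (E4.spatial y)) z := by
    have hfun : (fun y ↦ Kerr.blSigma a (E4.spatial y)) =
        fun y ↦ 2 * Kerr.radius a y ^ 2 - E4.spatialNorm y ^ 2 + a ^ 2 :=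
      funext fun y ↦ Kerr.blSigma_spatial_eq a y
    rw [hfun]
    exact ((contDiffAt_const.mul ((Kerr.contDiffAt_radius hz).pow 2)).sub
      Kerr.contDiff_spatialNorm_sq.contDiffAt).add contDiffAt_const
  have hV : ContDiffAt ℝ n (fun y ↦ Kerr.nullVector a y ν) z :=
    contDiffAt_euclidean.mp (Kerr.contDiffAt_nullVector a hz) ν
  exact ((contDiffAt_const.div hS (Kerr.blSigma_spatial_pos hz).ne')).neg.mul hV

/-- **The divergence coefficients are stationary**: `∂_{t*} c^ν = 0` where `r > 0`.
[cite: KerrSchild1965, §2] -/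
theorem fderiv_divInverseMetric_basisVector_zero (M a : ℝ) {z : E4} (hz : 0 < Kerr.radius a z)
    (ν : Fin 4) : fderiv ℝ (fun y ↦ Kerr.divInverseMetric M a y ν) z (E4.basisVector 0) = 0 := by
  have hd : DifferentiableAt ℝ (fun y ↦ Kerr.divInverseMetric M a y ν) z :=
    (contDiffAt_divInverseMetric M a hz ν (n := 1)).differentiableAt one_ne_zero
  have h1 : HasLineDerivAt ℝ (fun y ↦ Kerr.divInverseMetric M a y ν)
      (fderiv ℝ (fun y ↦ Kerr.divInverseMetric M a y ν) z (E4.basisVector 0)) z (E4.basisVector 0) :=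
    hd.hasFDerivAt.hasLineDerivAt _
  have h2 : HasLineDerivAt ℝ (fun y ↦ Kerr.divInverseMetric M a y ν) 0 z (E4.basisVector 0) := by
    have hconst : ∀ t : ℝ, Kerr.divInverseMetric M a (z + t • E4.basisVector 0) ν =
        Kerr.divInverseMetric M a z ν := by
      intro t
      have hzt : 0 < Kerr.radius a (z + t • E4.basisVector 0) := by
        rwa [Kerr.radius_add_smul_basisVector_zero]
      rw [Kerr.divInverseMetric_eq M a hzt, Kerr.divInverseMetric_eq M a hz,
        Kerr.nullVector_add_smul_basisVector_zero, Kerr.spatial_add_smul_basisVector_zero]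
    show HasDerivAt (fun t : ℝ ↦ Kerr.divInverseMetric M a (z + t • E4.basisVector 0) ν) 0 0
    simp only [hconst]
    exact hasDerivAt_const 0 _
  exact h1.unique h2

/-- **The wave operator commutes with `T = ∂_{t*}` (coordinate form).** For `Φ` smooth on `E4` let
`E[Φ](z) = ∑ g^{μν}(z) ∂_μ∂_νΦ(z) + ∑ c^ν(z) ∂_νΦ(z)`; then at points with `r > 0`,
`∂_{t*} E[Φ] = E[∂_{t*}Φ]` (stationarity `∂_{t*}g^{μν} = 0`, `∂_{t*}c^ν = 0`, and symmetry of
second and third derivatives). O'Neill 1995, Ch. 2, §2.2 (`∂_t` is Killing).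
[cite: ONeill1995, Ch. 2 §2.2] -/
theorem fderiv_waveCoord_basisVector_zero (M a : ℝ) {Φ : E4 → ℝ} (hΦ : ContDiff ℝ ∞ Φ) {z : E4}
    (hz : 0 < Kerr.radius a z) :
    fderiv ℝ (fun y ↦ ∑ μ, ∑ ν, Kerr.inverseMetric M a y μ ν *
        fderiv ℝ (fderiv ℝ Φ) y (E4.basisVector μ) (E4.basisVector ν) +
      ∑ ν, Kerr.divInverseMetric M a y ν * fderiv ℝ Φ y (E4.basisVector ν)) z (E4.basisVector 0) =
    ∑ μ, ∑ ν, Kerr.inverseMetric M a z μ ν *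
        fderiv ℝ (fderiv ℝ (fun y ↦ fderiv ℝ Φ y (E4.basisVector 0))) z
          (E4.basisVector μ) (E4.basisVector ν) +
      ∑ ν, Kerr.divInverseMetric M a z ν *
        fderiv ℝ (fun y ↦ fderiv ℝ Φ y (E4.basisVector 0)) z (E4.basisVector ν) := by
  have h1 : ContDiff ℝ ∞ (fderiv ℝ Φ) := hΦ.fderiv_right (m := ∞) le_rfl
  have h2 : ContDiff ℝ ∞ (fderiv ℝ (fderiv ℝ Φ)) := h1.fderiv_right (m := ∞) le_rfl
  have hd1 : Differentiable ℝ (fderiv ℝ Φ) := h1.differentiable (WithTop.coe_ne_zero.mpr ENat.top_ne_zero)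
  have hd2 : Differentiable ℝ (fderiv ℝ (fderiv ℝ Φ)) := h2.differentiable (WithTop.coe_ne_zero.mpr ENat.top_ne_zero)
  set T : E4 → ℝ := fun y ↦ fderiv ℝ Φ y (E4.basisVector 0) with hT
  -- derivatives of `T`
  have hTd : ∀ y, HasFDerivAt T ((fderiv ℝ (fderiv ℝ Φ) y).flip (E4.basisVector 0)) y := fun y ↦ by
    simpa using (hd1 y).hasFDerivAt.clm_apply (hasFDerivAt_const (E4.basisVector 0) y)
  have hT1 : ∀ y v, fderiv ℝ T y v = fderiv ℝ (fderiv ℝ Φ) y v (E4.basisVector 0) := fun y v ↦ by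
    rw [(hTd y).fderiv, ContinuousLinearMap.flip_apply]
  have hT1' : fderiv ℝ T = fun y ↦ (fderiv ℝ (fderiv ℝ Φ) y).flip (E4.basisVector 0) :=
    funext fun y ↦ (hTd y).fderiv
  have hTs : ContDiff ℝ ∞ T := h1.clm_apply contDiff_const
  have hT2 : ∀ u v, fderiv ℝ (fderiv ℝ T) z u v =
      fderiv ℝ (fderiv ℝ (fderiv ℝ Φ)) z u v (E4.basisVector 0) := by
    intro u v
    rw [← fderiv_clm_apply_const_apply ((hTs.fderiv_right (m := ∞) le_rfl).differentiable
      (WithTop.coe_ne_zero.mpr ENat.top_ne_zero) z) v u]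
    have hfun : (fun y ↦ fderiv ℝ T y v) = fun y ↦ fderiv ℝ (fderiv ℝ Φ) y v (E4.basisVector 0) :=
      funext fun y ↦ hT1 y v
    rw [hfun, fderiv_clm_apply_const_apply (c := fun y ↦ fderiv ℝ (fderiv ℝ Φ) y v) ?_,
      fderiv_clm_apply_const_apply (hd2 z)]
    exact ((hd2 z).hasFDerivAt.clm_apply (hasFDerivAt_const v z)).differentiableAt
  -- symmetry facts
  have hsym2 : ∀ y v, fderiv ℝ (fderiv ℝ Φ) y v (E4.basisVector 0) =
      fderiv ℝ (fderiv ℝ Φ) y (E4.basisVector 0) v := fun y v ↦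
    (hΦ.contDiffAt.isSymmSndFDerivAt minSmoothness_two_le_infty) v _
  have hsym3 : ∀ u v, fderiv ℝ (fderiv ℝ (fderiv ℝ Φ)) z u v (E4.basisVector 0) =
      fderiv ℝ (fderiv ℝ (fderiv ℝ Φ)) z (E4.basisVector 0) u v := fun u v ↦
    fderiv_fderiv_fderiv_cyclic hΦ z u v _
  -- differentiate the wave expression term by term
  have hg : ∀ μ ν, HasFDerivAt (fun y ↦ Kerr.inverseMetric M a y μ ν)
      (fderiv ℝ (fun y ↦ Kerr.inverseMetric M a y μ ν) z) z := fun μ ν ↦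
    ((Kerr.contDiffAt_inverseMetric M a hz μ ν (n := 1)).differentiableAt one_ne_zero).hasFDerivAt
  have hc : ∀ ν, HasFDerivAt (fun y ↦ Kerr.divInverseMetric M a y ν)
      (fderiv ℝ (fun y ↦ Kerr.divInverseMetric M a y ν) z) z := fun ν ↦
    ((contDiffAt_divInverseMetric M a hz ν (n := 1)).differentiableAt one_ne_zero).hasFDerivAt
  have hB : ∀ μ ν, HasFDerivAt (fun y ↦ fderiv ℝ (fderiv ℝ Φ) y (E4.basisVector μ) (E4.basisVector ν))
      (fderiv ℝ (fun y ↦ fderiv ℝ (fderiv ℝ Φ) y (E4.basisVector μ) (E4.basisVector ν)) z) z := by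
    intro μ ν
    have h := ((hd2 z).hasFDerivAt.clm_apply (hasFDerivAt_const (E4.basisVector μ) z))
    exact (h.clm_apply (hasFDerivAt_const (E4.basisVector ν) z)).differentiableAt.hasFDerivAt
  have hBv : ∀ μ ν, fderiv ℝ (fun y ↦ fderiv ℝ (fderiv ℝ Φ) y (E4.basisVector μ) (E4.basisVector ν)) z
      (E4.basisVector 0) = fderiv ℝ (fderiv ℝ (fderiv ℝ Φ)) z (E4.basisVector 0)
        (E4.basisVector μ) (E4.basisVector ν) := by
    intro μ ν
    rw [fderiv_clm_apply_const_apply (c := fun y ↦ fderiv ℝ (fderiv ℝ Φ) y (E4.basisVector μ)) ?_,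
      fderiv_clm_apply_const_apply (hd2 z)]
    exact ((hd2 z).hasFDerivAt.clm_apply (hasFDerivAt_const (E4.basisVector μ) z)).differentiableAt
  have hL : ∀ ν, HasFDerivAt (fun y ↦ fderiv ℝ Φ y (E4.basisVector ν))
      ((fderiv ℝ (fderiv ℝ Φ) z).flip (E4.basisVector ν)) z := fun ν ↦ by
    simpa using (hd1 z).hasFDerivAt.clm_apply (hasFDerivAt_const (E4.basisVector ν) z)
  have hsum := (HasFDerivAt.fun_sum fun μ (_ : μ ∈ Finset.univ) ↦
    HasFDerivAt.fun_sum fun ν (_ : ν ∈ Finset.univ) ↦ (hg μ ν).mul (hB μ ν)).add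
    (HasFDerivAt.fun_sum fun ν (_ : ν ∈ Finset.univ) ↦ (hc ν).mul (hL ν))
  rw [show (fun y ↦ ∑ μ, ∑ ν, Kerr.inverseMetric M a y μ ν *
        fderiv ℝ (fderiv ℝ Φ) y (E4.basisVector μ) (E4.basisVector ν) +
      ∑ ν, Kerr.divInverseMetric M a y ν * fderiv ℝ Φ y (E4.basisVector ν)) =
      ((fun y ↦ ∑ μ, ∑ ν, ((fun y ↦ Kerr.inverseMetric M a y μ ν) * fun y ↦
        fderiv ℝ (fderiv ℝ Φ) y (E4.basisVector μ) (E4.basisVector ν)) y) + fun y ↦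
        ∑ ν, ((fun y ↦ Kerr.divInverseMetric M a y ν) * fun y ↦ fderiv ℝ Φ y (E4.basisVector ν)) y)
      from rfl, hsum.fderiv]
  simp only [FunLike.coe_add, Pi.add_apply, FunLike.coe_sum, Finset.sum_apply, FunLike.coe_smul,
    Pi.smul_apply, smul_eq_mul, Kerr.fderiv_inverseMetric_basisVector_zero M a hz,
    fderiv_divInverseMetric_basisVector_zero M a hz, mul_zero, add_zero, hBv,
    ContinuousLinearMap.flip_apply, hT2, hT1, hsym3, hsym2]

/-- **The class of solutions is closed under `T = ∂_{t*}`.** If `Φ` is smooth on `E4` and the chart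
function `y ↦ Φ(y)` solves `□_g = 0` on an open set `U₀` of the chart, then so does
`y ↦ ∂_{t*}Φ(y)` (`□_g` in coordinates is `E[·]`, `E[Φ]` vanishes on the open image of `U₀`, so
`0 = ∂_{t*}E[Φ] = E[∂_{t*}Φ] = □_g(TΦ)`). O'Neill 1995, Ch. 2, §2.2. [cite: ONeill1995, Ch. 2 §2.2] -/
theorem dalembertian_timeDeriv_eq_zero [Kerr.Facts] [Kerr.SliceFacts] {M r₀ : ℝ} {Φ : E4 → ℝ}
    (hΦ : ContDiff ℝ ∞ Φ) {U₀ : Set (Kerr.region M r₀)} (hU₀ : IsOpen U₀)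
    (hsol : ∀ x ∈ U₀, (Kerr.smoothMetric M M r₀).toPseudoRiemannianMetric.dalembertian
      (fun y : Kerr.region M r₀ ↦ Φ y) x = 0) (x : Kerr.region M r₀) (hx : x ∈ U₀) :
    (Kerr.smoothMetric M M r₀).toPseudoRiemannianMetric.dalembertian
      (fun y : Kerr.region M r₀ ↦ fderiv ℝ Φ y (E4.basisVector 0)) x = 0 := by
  have hxpos : 0 < Kerr.radius M x := Kerr.radius_pos_of_mem_region x.2
  have hT : ContDiff ℝ ∞ (fun y ↦ fderiv ℝ Φ y (E4.basisVector 0)) :=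
    (hΦ.fderiv_right (m := ∞) le_rfl).clm_apply contDiff_const
  rw [dalembertian_eq_hessian_add_firstOrder M M r₀ (ψ := fun y : Kerr.region M r₀ ↦
    fderiv ℝ Φ y (E4.basisVector 0)) (Φ := fun y ↦ fderiv ℝ Φ y (E4.basisVector 0)) (fun _ ↦ rfl) x
    (hT.contDiffAt.of_le (WithTop.coe_le_coe.mpr le_top)),
    ← fderiv_waveCoord_basisVector_zero M M hΦ hxpos]
  -- the wave expression of `Φ` vanishes on the open set `val '' U₀ ∋ x`
  set E : E4 → ℝ := fun y ↦ ∑ μ, ∑ ν, Kerr.inverseMetric M M y μ ν *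
      fderiv ℝ (fderiv ℝ Φ) y (E4.basisVector μ) (E4.basisVector ν) +
    ∑ ν, Kerr.divInverseMetric M M y ν * fderiv ℝ Φ y (E4.basisVector ν) with hE
  have hopen : IsOpen (Subtype.val '' U₀ : Set E4) :=
    (Kerr.region M r₀).isOpen.isOpenMap_subtype_val U₀ hU₀
  have hzero : EqOn E (fun _ ↦ 0) (Subtype.val '' U₀) := by
    rintro _ ⟨y, hyU, rfl⟩
    have h := hsol y hyU
    rwa [dalembertian_eq_hessian_add_firstOrder M M r₀ (ψ := fun y : Kerr.region M r₀ ↦ Φ y) (Φ := Φ)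
      (fun _ ↦ rfl) y (hΦ.contDiffAt.of_le (WithTop.coe_le_coe.mpr le_top))] at h
  have h := fderiv_eq_of_eqOn_isOpen hopen hzero ⟨x, hx, rfl⟩
  show fderiv ℝ E x (E4.basisVector 0) = 0
  rw [h]
  simp

/-- **Tangential second derivatives vanish where the function and its differential vanish on the
leaf.** If `Φ` is `C²` near `x`, `x⁰ = 0`, and `DΦ = 0` at all points `y` of an open set `O ∋ x` with
`y⁰ = 0` and `‖y⃗‖ > ρ` (with `‖x⃗‖ > ρ`), then `D²Φ(x)(w, u) = 0` for every `w` tangent to the leaf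
(`w⁰ = 0`). [folklore] -/
theorem fderiv_fderiv_tangential_eq_zero {Φ : E4 → ℝ} {x : E4} (hΦ : ContDiffAt ℝ 2 Φ x)
    {O : Set E4} (hO : IsOpen O) (hxO : x ∈ O) (hx0 : x 0 = 0) {ρ : ℝ} (hxρ : ρ < E4.spatialNorm x)
    (hloc : ∀ y ∈ O, y 0 = 0 → ρ < E4.spatialNorm y → fderiv ℝ Φ y = 0) {w : E4} (hw : w 0 = 0)
    (u : E4) : fderiv ℝ (fderiv ℝ Φ) x w u = 0 := by
  have hd2 : DifferentiableAt ℝ (fderiv ℝ Φ) x :=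
    (hΦ.fderiv_right (m := 1) le_rfl).differentiableAt one_ne_zero
  rw [← fderiv_clm_apply_const_apply hd2 u w]
  have hd : DifferentiableAt ℝ (fun y ↦ fderiv ℝ Φ y u) x :=
    (hd2.hasFDerivAt.clm_apply (hasFDerivAt_const u x)).differentiableAt
  have h1 : HasLineDerivAt ℝ (fun y ↦ fderiv ℝ Φ y u) (fderiv ℝ (fun y ↦ fderiv ℝ Φ y u) x w) x w :=
    hd.hasFDerivAt.hasLineDerivAt _
  have h2 : HasLineDerivAt ℝ (fun y ↦ fderiv ℝ Φ y u) 0 x w := by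
    have hg : Continuous fun t : ℝ ↦ x + t • w := continuous_const.add (continuous_id.smul continuous_const)
    have hev1 : ∀ᶠ t : ℝ in 𝓝 0, x + t • w ∈ O := by
      refine hg.continuousAt.eventually_mem ?_
      rw [zero_smul, add_zero]
      exact hO.mem_nhds hxO
    have hev2 : ∀ᶠ t : ℝ in 𝓝 0, ρ < E4.spatialNorm (x + t • w) := by
      have hc : Continuous fun t : ℝ ↦ E4.spatialNorm (x + t • w) :=
        (continuous_norm.comp E4.spatial.continuous).comp hg
      have ht : Tendsto (fun t : ℝ ↦ E4.spatialNorm (x + t • w)) (𝓝 0) (𝓝 (E4.spatialNorm x)) := by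
        have h := hc.continuousAt (x := 0)
        rwa [ContinuousAt, show E4.spatialNorm (x + (0 : ℝ) • w) = E4.spatialNorm x by
          rw [zero_smul, add_zero]] at h
      exact ht.eventually_const_lt hxρ
    have hev : (fun t : ℝ ↦ fderiv ℝ Φ (x + t • w) u) =ᶠ[𝓝 0] fun _ ↦ (0 : ℝ) := by
      filter_upwards [hev1, hev2] with t ht1 ht2
      have ht0 : (x + t • w) 0 = 0 := by
        rw [PiLp.add_apply, PiLp.smul_apply, smul_eq_mul, hx0, hw, mul_zero, add_zero]
      rw [hloc _ ht1 ht0 ht2, _root_.zero_apply]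
    show HasDerivAt (fun t : ℝ ↦ fderiv ℝ Φ (x + t • w) u) 0 0
    exact (hasDerivAt_const (0 : ℝ) (0 : ℝ)).congr_of_eventuallyEq hev
  exact h1.unique h2

/-- **The `t*`-derivative of a localised solution is localised.** Let `Φ` be smooth on `E4`, solve
`□_g = 0` (as a chart function) on the open `U₀`, and vanish together with `DΦ` at the points of
`U₀ ∩ {t* = 0}` with `‖x⃗‖ > ρ`. Then `TΦ = ∂_{t*}Φ` vanishes there together with `D(TΦ)`: the
tangential second derivatives vanish by differentiating along the leaf, and `∂²_{t*}Φ` by the wave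
equation, whose coefficient `g^{t*t*} = −1 − 2H < 0` (`H ≥ 0` for `M ≥ 0`). [folklore] -/
theorem timeDeriv_localised [Kerr.Facts] [Kerr.SliceFacts] {M r₀ : ℝ} (hM : 0 ≤ M) {Φ : E4 → ℝ}
    (hΦ : ContDiff ℝ ∞ Φ) {U₀ : Set (Kerr.region M r₀)} (hU₀ : IsOpen U₀)
    (hsol : ∀ x ∈ U₀, (Kerr.smoothMetric M M r₀).toPseudoRiemannianMetric.dalembertian
      (fun y : Kerr.region M r₀ ↦ Φ y) x = 0)
    {ρ : ℝ} (hloc : ∀ x ∈ U₀, (x : E4) 0 = 0 → ρ < E4.spatialNorm (x : E4) →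
      Φ x = 0 ∧ fderiv ℝ Φ x = 0)
    (x : Kerr.region M r₀) (hx : x ∈ U₀) (hx0 : (x : E4) 0 = 0) (hxρ : ρ < E4.spatialNorm (x : E4)) :
    fderiv ℝ Φ x (E4.basisVector 0) = 0 ∧
      fderiv ℝ (fun y ↦ fderiv ℝ Φ y (E4.basisVector 0)) x = 0 := by
  have hd1 : Differentiable ℝ (fderiv ℝ Φ) := (hΦ.fderiv_right (m := ∞) le_rfl).differentiable (WithTop.coe_ne_zero.mpr ENat.top_ne_zero)
  refine ⟨by rw [(hloc x hx hx0 hxρ).2, _root_.zero_apply], ?_⟩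
  -- the open set of `E4` over `U₀`
  set O : Set E4 := Subtype.val '' U₀ with hOdef
  have hO : IsOpen O := (Kerr.region M r₀).isOpen.isOpenMap_subtype_val U₀ hU₀
  have hxO : (x : E4) ∈ O := ⟨x, hx, rfl⟩
  have hlocO : ∀ y ∈ O, y 0 = 0 → ρ < E4.spatialNorm y → fderiv ℝ Φ y = 0 := by
    rintro _ ⟨y, hyU, rfl⟩ hy0 hyρ
    exact (hloc y hyU hy0 hyρ).2
  have htan : ∀ w : E4, w 0 = 0 → ∀ u, fderiv ℝ (fderiv ℝ Φ) x w u = 0 := fun w hw u ↦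
    fderiv_fderiv_tangential_eq_zero (hΦ.contDiffAt.of_le (WithTop.coe_le_coe.mpr le_top)) hO hxO hx0
      hxρ hlocO hw u
  have hsym : ∀ v w, fderiv ℝ (fderiv ℝ Φ) x v w = fderiv ℝ (fderiv ℝ Φ) x w v := fun v w ↦
    (hΦ.contDiffAt.isSymmSndFDerivAt minSmoothness_two_le_infty) v w
  -- `∂²_{t*} Φ (x) = 0` from the wave equation
  have h00 : fderiv ℝ (fderiv ℝ Φ) x (E4.basisVector 0) (E4.basisVector 0) = 0 := by
    have h := hsol x hx
    rw [dalembertian_eq_hessian_add_firstOrder M M r₀ (ψ := fun y : Kerr.region M r₀ ↦ Φ y) (Φ := Φ)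
      (fun _ ↦ rfl) x (hΦ.contDiffAt.of_le (WithTop.coe_le_coe.mpr le_top)), (hloc x hx hx0 hxρ).2] at h
    have hb : ∀ μ : Fin 4, μ ≠ 0 → (E4.basisVector μ) 0 = 0 := fun μ hμ ↦ by
      rw [basisVector_apply, if_neg hμ.symm]
    have hz1 : ∀ μ : Fin 4, μ ≠ 0 → ∀ ν, fderiv ℝ (fderiv ℝ Φ) x (E4.basisVector μ) (E4.basisVector ν) = 0 :=
      fun μ hμ ν ↦ htan _ (hb μ hμ) _
    have hz2 : ∀ ν : Fin 4, ν ≠ 0 → fderiv ℝ (fderiv ℝ Φ) x (E4.basisVector 0) (E4.basisVector ν) = 0 :=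
      fun ν hν ↦ by rw [hsym, hz1 ν hν]
    simp only [Fin.sum_univ_four, _root_.zero_apply, mul_zero, add_zero, Fin.isValue,
      hz1 1 one_ne_zero, hz1 2 (by decide), hz1 3 (by decide), hz2 1 one_ne_zero, hz2 2 (by decide),
      hz2 3 (by decide)] at h
    -- `g^{00} = −1 − 2H ≠ 0`
    have hg : Kerr.inverseMetric M M x 0 0 = -1 - 2 * Kerr.scalarH M M x := by
      rw [Kerr.inverseMetric_apply, Kerr.nullVector_apply_zero]
      simp
    have hH := Kerr.scalarH_nonneg hM M (x : E4)
    rw [hg] at h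
    have hne : (-1 - 2 * Kerr.scalarH M M x) ≠ 0 := by linarith
    exact (mul_eq_zero.mp h).resolve_left hne
  -- assemble: `D(TΦ)(x) v = D²Φ(x)(v, ∂₀) = v⁰ D²Φ(∂₀,∂₀) + D²Φ(tangential, ∂₀) = 0`
  ext v
  rw [fderiv_clm_apply_const_apply (hd1 x), _root_.zero_apply,
    eq_time_smul_add_ofTimeSpace_spatial v, map_add, map_smul]
  simp only [FunLike.coe_add, Pi.add_apply, FunLike.coe_smul, Pi.smul_apply, smul_eq_mul, h00,
    mul_zero, zero_add]
  exact htan _ (by simp) _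

end Literature.Barriers.FinalStateConjecture.Kerr

end
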